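import Mathlib
import HarnessLib
import Literature.Geometry.Lorentzian.KerrWaveEnergyProofs
import Literature.Geometry.Lorentzian.KerrTimeDerivative
import Literature.Geometry.Lorentzian.KerrSchildWaveCauchyProblem
import Literature.Geometry.Lorentzian.KerrHyperboloidalLeaves

/-!
# Route ZeroEnergyKerrOrBomb · item `KerrModeStability` — truncated Cauchy data on the
# Kerr–Schild leaf

Helper file for item stmt-FinalStateConjecture-10024 (`KerrModeStability`). For a pair of smooth
functions `ψ, χ` on a horizon-penetrating chart `Kerr.region a r₀` (`r₋ < r₀ < r₊`) and a radius
`R₀ > 0` it constructs smooth, compactly supported Cauchy data `(d₀, d₁)` on `E3 = {t* = 0}`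
which agree with the data `(ψ, νψ − ωχ)` of `ψ` on the exterior part `{r > r₊}` of the ball
`{‖y‖ ≤ R₀}`, vanish beyond `‖y‖ = R₀ + 1`, and whose size and slope are controlled by those of
`ψ, χ` and a universal constant (`kerrMode_data_exists`). Ingredients: the radial transition
`radialTransition R₀ 1` of `KerrWaveEnergyProofs.lean` (cut-off towards infinity) and the horizon
cut-off `x ↦ Kerr.innerCutoff (r₊ − r₀) (r(x) − r₀)` (`= 1` on `{r ≥ r₊}`, `= 0` on
`{r ≤ (r₀ + r₊)/2}`), which makes the product with a function smooth only on `{r > r₀}` smooth on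
all of `ℝ⁴`. These data are fed to the Cauchy-problem fact `Kerr.exists_wave_of_data` in the energy
argument of the item. No new definitions.
-/

noncomputable section

namespace Summit.FinalStateConjecture.FinalStateConjecture.Theorems

open Literature.Geometry.Lorentzian Set Filter
open scoped Manifold ContDiff Topology

-- every `Summit.FinalStateConjecture.FinalStateConjecture.…` name repeats the summit = sub-problem segment (D-0017 layout)
set_option linter.dupNamespace false

/-! ### Calculus along the slice -/

/-- The slice embedding sends the coordinate vector `e_i` of `E3` to `∂_{i+1}`. -/
theorem kerr_spaceEmbed_single (i : Fin 3) :
    E4.spaceEmbed (EuclideanSpace.single i (1 : ℝ)) = E4.basisVector i.succ := by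
  ext j
  refine Fin.cases ?_ (fun k ↦ ?_) j
  · simp [E4.basisVector, Fin.succ_ne_zero]
  · simp [E4.basisVector, Fin.succ_inj]

/-- Chain rule along the slice `{t* = t}`: `∂_{y_i} [F(t, y)] = (∂_{i+1} F)(t, y)`. -/
theorem kerr_fderiv_comp_ofTimeSpace_single {F : E4 → ℝ} {t : ℝ} {y : E3}
    (hF : DifferentiableAt ℝ F (E4.ofTimeSpace t y)) (i : Fin 3) :
    fderiv ℝ (fun y ↦ F (E4.ofTimeSpace t y)) y (EuclideanSpace.single i 1) =
      fderiv ℝ F (E4.ofTimeSpace t y) (E4.basisVector i.succ) := by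
  have h : HasFDerivAt (fun y ↦ F (E4.ofTimeSpace t y))
      ((fderiv ℝ F (E4.ofTimeSpace t y)).comp E4.spaceEmbed) y :=
    hF.hasFDerivAt.comp y (E4.hasFDerivAt_ofTimeSpace t y)
  rw [h.fderiv, ContinuousLinearMap.comp_apply, kerr_spaceEmbed_single]

/-- A function on `ℝ⁴` vanishing on `{r < c}` and `C^n` at every point of `{r > c'}`, `c' < c`, is
`C^n` on all of `ℝ⁴` (variant of `Kerr.contDiff_of_eq_zero_of_radius_lt` with two radii). -/
theorem kerr_contDiff_of_eq_zero_of_radius_lt {a c c' : ℝ} (hcc : c' < c) {n : WithTop ℕ∞}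
    {f : E4 → ℝ} (h0 : ∀ x, Kerr.radius a x < c → f x = 0)
    (hs : ∀ x, c' < Kerr.radius a x → ContDiffAt ℝ n f x) : ContDiff ℝ n f := by
  rw [contDiff_iff_contDiffAt]
  intro x
  by_cases hx : c' < Kerr.radius a x
  · exact hs x hx
  · have hlt : Kerr.radius a x < c := by linarith [not_lt.mp hx]
    have hev : ∀ᶠ y in 𝓝 x, Kerr.radius a y < c :=
      (Kerr.continuous_radius a).continuousAt.eventually_lt continuousAt_const hlt
    refine (contDiffAt_const (c := (0 : ℝ))).congr_of_eventuallyEq ?_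
    filter_upwards [hev] with y hy
    exact h0 y hy

/-! ### The horizon cut-off `x ↦ χ_{r₊−r₀}(r(x) − r₀)` -/

/-- The horizon cut-off equals `1` on `{r ≥ r₊}`. -/
theorem kerr_horizonCutoff_eq_one {a r₀ rp : ℝ} (h : r₀ < rp) {x : E4} (hx : rp ≤ Kerr.radius a x) :
    Kerr.innerCutoff (rp - r₀) (Kerr.radius a x - r₀) = 1 :=
  Kerr.innerCutoff_eq_one (by linarith) (by linarith)

/-- The horizon cut-off vanishes on `{r ≤ (r₀ + r₊)/2}`. -/
theorem kerr_horizonCutoff_eq_zero {a r₀ rp : ℝ} (h : r₀ < rp) {x : E4}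
    (hx : Kerr.radius a x ≤ (r₀ + rp) / 2) :
    Kerr.innerCutoff (rp - r₀) (Kerr.radius a x - r₀) = 0 :=
  Kerr.innerCutoff_eq_zero (by linarith) (by linarith)

/-- The horizon cut-off is smooth at every point with `r > 0`. -/
theorem kerr_contDiffAt_horizonCutoff {a r₀ rp : ℝ} {x : E4} (hx : 0 < Kerr.radius a x)
    {n : ℕ∞} :
    ContDiffAt ℝ n (fun x ↦ Kerr.innerCutoff (rp - r₀) (Kerr.radius a x - r₀)) x := by
  have h1 : ContDiffAt ℝ n (fun x ↦ Kerr.radius a x - r₀) x :=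
    (Kerr.contDiffAt_radius hx).sub contDiffAt_const
  exact (Kerr.contDiff_innerCutoff (rp - r₀)).contDiffAt.comp x h1

/-- **The horizon cut-off makes a function smooth on `{r > r₀}` smooth on `ℝ⁴`**: for
`0 ≤ r₀ < r₊` and `f` of class `C^n` at every point with `r > r₀`, the product
`x ↦ χ(r(x) − r₀) f(x)` is `C^n` on `E4` (it vanishes on `{r < (r₀ + r₊)/2}`). -/
theorem kerr_contDiff_horizonCutoff_mul {a r₀ rp : ℝ} (hr₀ : 0 ≤ r₀) (h : r₀ < rp)
    {n : ℕ∞} {f : E4 → ℝ} (hf : ∀ x, r₀ < Kerr.radius a x → ContDiffAt ℝ n f x) :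
    ContDiff ℝ n fun x ↦ Kerr.innerCutoff (rp - r₀) (Kerr.radius a x - r₀) * f x := by
  refine kerr_contDiff_of_eq_zero_of_radius_lt (a := a) (c := (r₀ + rp) / 2) (c' := r₀)
    (by linarith) (fun x hx ↦ by rw [kerr_horizonCutoff_eq_zero h hx.le, zero_mul]) fun x hx ↦ ?_
  exact (kerr_contDiffAt_horizonCutoff (by linarith)).mul (hf x hx)

/-! ### The radial cut-off towards infinity `y ↦ 1 − u_{R₀,1}(y)` -/

/-- The radial cut-off is `1` on the closed ball of radius `R₀`. -/
theorem kerr_radialCutoff_eq_one {R₀ : ℝ} {y : E3} (hy : ‖y‖ ≤ R₀) :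
    1 - radialTransition R₀ 1 y = 1 := by
  rw [radialTransition_of_norm_le one_pos hy, sub_zero]

/-- The radial cut-off vanishes beyond radius `R₀ + 1`. -/
theorem kerr_radialCutoff_eq_zero {R₀ : ℝ} {y : E3} (hy : R₀ + 1 ≤ ‖y‖) :
    1 - radialTransition R₀ 1 y = 0 := by
  rw [radialTransition_of_le_norm one_pos hy, sub_self]

/-- The radial cut-off takes values in `[0, 1]`, so its absolute value is at most `1`. -/
theorem kerr_abs_radialCutoff_le (R₀ : ℝ) (y : E3) : |1 - radialTransition R₀ 1 y| ≤ 1 := by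
  have h0 := radialTransition_nonneg R₀ 1 y
  have h1 := radialTransition_le_one R₀ 1 y
  rw [abs_le]; constructor <;> linarith

/-- The radial cut-off is smooth (`R₀ > 0`). -/
theorem kerr_contDiff_radialCutoff {R₀ : ℝ} (hR₀ : 0 < R₀) {n : ℕ∞} :
    ContDiff ℝ n fun y : E3 ↦ 1 - radialTransition R₀ 1 y :=
  contDiff_const.sub (contDiff_radialTransition hR₀ one_pos)

/-- The slope of the radial cut-off is bounded by a bound `K` for `|smoothTransition'|`. -/
theorem kerr_norm_fderiv_radialCutoff_le {R₀ K : ℝ} (hR₀ : 0 < R₀)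
    (hK : ∀ t, |deriv Real.smoothTransition t| ≤ K) (y : E3) :
    ‖fderiv ℝ (fun y : E3 ↦ 1 - radialTransition R₀ 1 y) y‖ ≤ K := by
  have hd : DifferentiableAt ℝ (radialTransition R₀ 1) y :=
    (contDiff_radialTransition hR₀ one_pos (n := 1)).differentiable (by simp) y
  rw [fderiv_const_sub, norm_neg]
  simpa using norm_fderiv_radialTransition_le hR₀ one_pos hK y

/-! ### The truncated data -/

/-- **Truncated Cauchy data for a horizon-regular pair.** Let `(M, a)` be subextremal,
`r₋ < r₀ < r₊`, `ψ, χ` smooth on `Kerr.region a r₀` with extensions by zero `ψ̃, χ̃`, `ν, ω ∈ ℝ`,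
`R₀ > 0`, and `K` a bound for `|smoothTransition'|`. There are smooth, compactly supported
`d₀, d₁ : E3 → ℝ` with: `d₀ = d₁ = 0` on `{‖y‖ ≥ R₀ + 1}`; on the exterior slice
(`r(0, y) > r₊`): `d₀(y) = ψ̃(0, y)` and `d₁(y) = ν ψ̃(0, y) − ω χ̃(0, y)` whenever `‖y‖ ≤ R₀`,
`|d₀(y)| ≤ |ψ̃(0, y)|`, `|d₁(y)| ≤ |ν| |ψ̃(0, y)| + |ω| |χ̃(0, y)|`, and
`|∂_{y_i} d₀(y)| ≤ |∂_{i+1} ψ̃(0, y)| + K |ψ̃(0, y)|`. Construction: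
`d₀(y) = (1 − u_{R₀,1}(y)) χ(r − r₀) ψ̃(0, y)`, `d₁(y) = (1 − u_{R₀,1}(y)) χ(r − r₀) (νψ̃ − ωχ̃)(0, y)`
with the horizon cut-off `χ(r − r₀) = Kerr.innerCutoff (r₊ − r₀) (r − r₀)` (`= 1` on the exterior). -/
theorem kerrMode_data_exists {M a r₀ : ℝ} (hMa : Kerr.IsSubextremal M a)
    (hrm : Kerr.rMinus M a < r₀) (hr : r₀ < Kerr.rPlus M a) {ψ χ : Kerr.region a r₀ → ℝ}
    (hψ : ContMDiff 𝓘(ℝ, E4) 𝓘(ℝ, ℝ) ∞ ψ) (hχ : ContMDiff 𝓘(ℝ, E4) 𝓘(ℝ, ℝ) ∞ χ) (ν w : ℝ)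
    {R₀ K : ℝ} (hR₀ : 0 < R₀) (hK : ∀ t, |deriv Real.smoothTransition t| ≤ K) :
    ∃ d₀ d₁ : E3 → ℝ, ContDiff ℝ ∞ d₀ ∧ ContDiff ℝ ∞ d₁ ∧
      HasCompactSupport d₀ ∧ HasCompactSupport d₁ ∧
      (∀ y : E3, R₀ + 1 ≤ ‖y‖ → d₀ y = 0 ∧ d₁ y = 0) ∧
      (∀ y : E3, Kerr.rPlus M a < Kerr.radius a (E4.ofTimeSpace 0 y) → ‖y‖ ≤ R₀ →
        d₀ y = Function.extend Subtype.val ψ 0 (E4.ofTimeSpace 0 y) ∧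
        d₁ y = ν * Function.extend Subtype.val ψ 0 (E4.ofTimeSpace 0 y) -
          w * Function.extend Subtype.val χ 0 (E4.ofTimeSpace 0 y)) ∧
      (∀ y : E3, Kerr.rPlus M a < Kerr.radius a (E4.ofTimeSpace 0 y) →
        |d₀ y| ≤ |Function.extend Subtype.val ψ 0 (E4.ofTimeSpace 0 y)| ∧
        |d₁ y| ≤ |ν| * |Function.extend Subtype.val ψ 0 (E4.ofTimeSpace 0 y)| +
          |w| * |Function.extend Subtype.val χ 0 (E4.ofTimeSpace 0 y)| ∧
        ∀ i : Fin 3, |fderiv ℝ d₀ y (EuclideanSpace.single i 1)| ≤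
          |fderiv ℝ (Function.extend Subtype.val ψ 0) (E4.ofTimeSpace 0 y)
              (E4.basisVector i.succ)| +
            K * |Function.extend Subtype.val ψ 0 (E4.ofTimeSpace 0 y)|) := by
  set rp := Kerr.rPlus M a with hrp_def
  have hr₀0 : 0 ≤ r₀ := hMa.rMinus_nonneg.trans hrm.le
  set Φ : E4 → ℝ := Function.extend Subtype.val ψ 0 with hΦ_def
  set X : E4 → ℝ := Function.extend Subtype.val χ 0 with hX_def
  have hreg : ∀ x : E4, r₀ < Kerr.radius a x → x ∈ Kerr.region a r₀ := fun x hx ↦ by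
    rw [Kerr.mem_region]; exact max_lt hx (hr₀0.trans_lt hx)
  have hΦs : ∀ x : E4, r₀ < Kerr.radius a x → ContDiffAt ℝ ∞ Φ x := fun x hx ↦
    contDiffAt_extend hψ ⟨x, hreg x hx⟩
  have hXs : ∀ x : E4, r₀ < Kerr.radius a x → ContDiffAt ℝ ∞ X x := fun x hx ↦
    contDiffAt_extend hχ ⟨x, hreg x hx⟩
  -- the horizon cut-off and the smooth products
  set Θ : E4 → ℝ := fun x ↦ Kerr.innerCutoff (rp - r₀) (Kerr.radius a x - r₀) with hΘ_def
  set P : E4 → ℝ := fun x ↦ Θ x * Φ x with hP_def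
  set Q : E4 → ℝ := fun x ↦ Θ x * (ν * Φ x - w * X x) with hQ_def
  have hP : ContDiff ℝ ∞ P := kerr_contDiff_horizonCutoff_mul hr₀0 hr hΦs
  have hQ : ContDiff ℝ ∞ Q := kerr_contDiff_horizonCutoff_mul hr₀0 hr fun x hx ↦
    (contDiffAt_const.mul (hΦs x hx)).sub (contDiffAt_const.mul (hXs x hx))
  have hΘ1 : ∀ y : E3, rp < Kerr.radius a (E4.ofTimeSpace 0 y) → Θ (E4.ofTimeSpace 0 y) = 1 :=
    fun y hy ↦ kerr_horizonCutoff_eq_one hr hy.le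
  -- the radial cut-off
  set η : E3 → ℝ := fun y ↦ 1 - radialTransition R₀ 1 y with hη_def
  have hη : ContDiff ℝ ∞ η := kerr_contDiff_radialCutoff hR₀
  have hη1 : ∀ y : E3, ‖y‖ ≤ R₀ → η y = 1 := fun y hy ↦ kerr_radialCutoff_eq_one hy
  have hη0 : ∀ y : E3, R₀ + 1 ≤ ‖y‖ → η y = 0 := fun y hy ↦ kerr_radialCutoff_eq_zero hy
  have hηabs : ∀ y : E3, |η y| ≤ 1 := kerr_abs_radialCutoff_le R₀
  have hηd : ∀ y : E3, ‖fderiv ℝ η y‖ ≤ K := kerr_norm_fderiv_radialCutoff_le hR₀ hK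
  -- the data
  set d₀ : E3 → ℝ := fun y ↦ η y * P (E4.ofTimeSpace 0 y) with hd₀_def
  set d₁ : E3 → ℝ := fun y ↦ η y * Q (E4.ofTimeSpace 0 y) with hd₁_def
  have hslice : ContDiff ℝ ∞ (E4.ofTimeSpace 0) := E4.contDiff_ofTimeSpace 0
  have hd₀ : ContDiff ℝ ∞ d₀ := hη.mul (hP.comp hslice)
  have hd₁ : ContDiff ℝ ∞ d₁ := hη.mul (hQ.comp hslice)
  have hsupp : ∀ f : E3 → ℝ, (∀ y : E3, R₀ + 1 ≤ ‖y‖ → f y = 0) → HasCompactSupport f := by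
    intro f hf
    refine HasCompactSupport.of_support_subset_isCompact (isCompact_closedBall (0 : E3) (R₀ + 1))
      fun y hy ↦ ?_
    rw [Metric.mem_closedBall, dist_zero_right]
    by_contra h
    exact hy (hf y (le_of_lt (not_le.mp h)))
  have hd₀0 : ∀ y : E3, R₀ + 1 ≤ ‖y‖ → d₀ y = 0 := fun y hy ↦ by
    simp only [hd₀_def, hη0 y hy, zero_mul]
  have hd₁0 : ∀ y : E3, R₀ + 1 ≤ ‖y‖ → d₁ y = 0 := fun y hy ↦ by
    simp only [hd₁_def, hη0 y hy, zero_mul]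
  refine ⟨d₀, d₁, hd₀, hd₁, hsupp d₀ hd₀0, hsupp d₁ hd₁0, fun y hy ↦ ⟨hd₀0 y hy, hd₁0 y hy⟩,
    fun y hy hyR ↦ ?_, fun y hy ↦ ⟨?_, ?_, fun i ↦ ?_⟩⟩
  · -- agreement with the data of `ψ` on the exterior part of the ball
    constructor
    · simp only [hd₀_def, hP_def, hη1 y hyR, hΘ1 y hy, one_mul]
    · simp only [hd₁_def, hQ_def, hη1 y hyR, hΘ1 y hy, one_mul]
  · -- `|d₀| ≤ |ψ̃|`
    simp only [hd₀_def, hP_def, hΘ1 y hy, one_mul, abs_mul]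
    exact mul_le_of_le_one_left (abs_nonneg _) (hηabs y)
  · -- `|d₁| ≤ |ν||ψ̃| + |ω||χ̃|`
    simp only [hd₁_def, hQ_def, hΘ1 y hy, one_mul, abs_mul]
    calc |η y| * |ν * Φ (E4.ofTimeSpace 0 y) - w * X (E4.ofTimeSpace 0 y)|
        ≤ 1 * |ν * Φ (E4.ofTimeSpace 0 y) - w * X (E4.ofTimeSpace 0 y)| :=
          mul_le_mul_of_nonneg_right (hηabs y) (abs_nonneg _)
      _ ≤ |ν| * |Φ (E4.ofTimeSpace 0 y)| + |w| * |X (E4.ofTimeSpace 0 y)| := by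
          rw [one_mul, ← abs_mul, ← abs_mul]; exact abs_sub _ _
  · -- the slope of `d₀`: near `y`, `d₀ = η · ψ̃(0, ·)`
    have hy0 : 0 < Kerr.radius a (E4.ofTimeSpace 0 y) := hMa.rPlus_pos.trans hy
    have hev : d₀ =ᶠ[𝓝 y] fun y' ↦ η y' * Φ (E4.ofTimeSpace 0 y') := by
      have hopen : IsOpen {y' : E3 | rp < Kerr.radius a (E4.ofTimeSpace 0 y')} :=
        isOpen_lt continuous_const ((Kerr.continuous_radius a).comp (E4.continuous_ofTimeSpace 0))
      filter_upwards [hopen.mem_nhds hy] with y' hy'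
      simp only [hd₀_def, hP_def, hΘ1 y' hy', one_mul]
    have hΦy : DifferentiableAt ℝ Φ (E4.ofTimeSpace 0 y) :=
      (hΦs _ (hr.trans hy)).differentiableAt (by simp)
    have hΦhat : DifferentiableAt ℝ (fun y' ↦ Φ (E4.ofTimeSpace 0 y')) y :=
      hΦy.comp y (E4.hasFDerivAt_ofTimeSpace 0 y).differentiableAt
    have hηy : DifferentiableAt ℝ η y := (hη.differentiable (by simp)) y
    rw [hev.fderiv_eq, fderiv_fun_mul hηy hΦhat, _root_.add_apply]
    rw [_root_.smul_apply, _root_.smul_apply, kerr_fderiv_comp_ofTimeSpace_single hΦy i,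
      smul_eq_mul, smul_eq_mul]
    have h1 : |η y * fderiv ℝ Φ (E4.ofTimeSpace 0 y) (E4.basisVector i.succ)| ≤
        |fderiv ℝ Φ (E4.ofTimeSpace 0 y) (E4.basisVector i.succ)| := by
      rw [abs_mul]; exact mul_le_of_le_one_left (abs_nonneg _) (hηabs y)
    have h2 : |Φ (E4.ofTimeSpace 0 y) * fderiv ℝ η y (EuclideanSpace.single i 1)| ≤
        K * |Φ (E4.ofTimeSpace 0 y)| := by
      rw [abs_mul, mul_comm]
      refine mul_le_mul_of_nonneg_right ?_ (abs_nonneg _)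
      calc |fderiv ℝ η y (EuclideanSpace.single i 1)|
          ≤ ‖fderiv ℝ η y‖ * ‖(EuclideanSpace.single i (1 : ℝ) : E3)‖ := by
            rw [← Real.norm_eq_abs]; exact ContinuousLinearMap.le_opNorm _ _
        _ ≤ K * 1 := by
            gcongr
            · exact (abs_nonneg _).trans (hK 0)
            · exact hηd y
            · simp
        _ = K := mul_one K
    exact (abs_add_le _ _).trans (add_le_add h1 h2)

end Summit.FinalStateConjecture.FinalStateConjecture.Theorems

end
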